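import Summits.QuantumFields.YangMills.Theorems.BalabanUVNodesN16AtRecord11
import Literature.MathematicalPhysics.QuantumFieldTheory.Balaban1983to89.Node00.RateRecord11
import Literature.MathematicalPhysics.QuantumFieldTheory.Balaban1983to89.Node00.Record11DatumKey
import HarnessLib

/-!
# Route «BalabanUVNodes», cluster K4 «SpineRates» — node N16 = NE3 AT THE BUNDLES OF THE RATE-RECORD HOME (layer A `Node00/RateRecord11`, p455395; key
# `Node00/Record11DatumKey`, p455304): N16's record decl at the NE3 bundle of record `⟨ne3LOfRecord₁₁ F, o.Nper, o.ε, o.b, o.g, o.C, o.Λ₁, o.Λ₂', o.dom⟩` of ONE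
# construction's objects `o : Node00.NE3Objects₁₁ N` at run length `k` — READ (`Iff.rfl`), CLOSED IN ONE APPLICATION from the proviso `InEndRegime` and the
# slot `PrintSlot` (file 1), the K4 stub `S_N16` at EVERY home admitting only such bundles at the datum key `IsDatumOfRecord₁₁C` (layer B's announced `RRec₁₁ 𝔯 𝔱`
# shape, WITH the run-length index), N21's face there, and the junk tests AT THE OBJECT TYPE: the residual assignment `𝔯` decides everything

Cell `pub-ymgap`, seat `pub-ymgap-dag-n16-e` (R134 acceleration seat (a), strategy s2 = BY-NAME KNIT at the ₁₁ record; HUMAN RULING D-0062; chair R424 venue),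
generation 0, file 3 (THEOREMS ONLY, 0 `def`, 0 `sorry`).  `bears_on: R4∕N16 · K3 SpineGivenEndpointR11`.  Filed `--supports stmt-QuantumFields-19676`.  Imports this
seat's file 2 `BalabanUVNodesN16AtRecord11` (p455642; through it file 1 `…N16RegimeDefs` p455532: `PrintSlot`, `InEndRegime`, `radiusOfRecord`, `constOfRecord`,
`n16At_of_inEndRegime_printSlot`) and NODE 00's rate-record home LAYER A (`Node00/RateRecord11.lean` p455395, seat node00-def-RR-1: `NE3Objects₁₁ N`,
`ne3LOfRecord₁₁ F = F.L`, `RateObjects₁₁ N` with `ne3 : ℕ → NE3Objects₁₁ N` per run length, the RESIDUAL assignment `RateAssignment₁₁ N`, `nonempty_rateObjects₁₁`) + the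
KEY OF RECORD (`Node00/Record11DatumKey.lean` p455304, seat node00-def-RR-2: `IsDatumOfRecord₁₁C F N D`, `.params`, `.forall_params`).  Pattern = dag-n18-d's
`BalabanUVNodesN18AtRateRecord11` (N18 at the home's level bundle, stated at the LITERAL so that layer B's one-application is `exact` whatever spelling it gives
`ne3OfRecord₁₁`); layer B itself (`RRec₁₁ 𝔯 𝔱`, `ne3OfRecord₁₁`; seat dag-n22-e, dag-lead WORDS-99∕101) is NOT in the tree at filing and is NOT typed here.

THE HOME's N16 SLOT (RR-1 INTENT-1 14:54Z + RR-2 LANDED-1 16:13Z, pub-ymgap INBOX l.12283 ∕ l.12546): the NE3 bundle of a datum of record `D` (key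
`hD : IsDatumOfRecord₁₁C F N D`, canonical parameter `hD.params`) along `(g₀, os)` at run length `k` is `ne3OfRecord₁₁ F o := ⟨F.L, o.Nper, o.ε, o.b, o.g, o.C, o.Λ₁, o.Λ₂',
o.dom⟩` with `o := (𝔯 F hD.params g₀ os).ne3 k`, `𝔯 : RateAssignment₁₁ N` the residual assignment (PINNED LATER BY NAME — «N16's data → `ne3 k`»); `RRec₁₁ 𝔯 𝔱 F D g₀ os R
:↔ ∃ hD k, R = ⟨…, ne3OfRecord₁₁ F ((𝔯 F hD.params g₀ os).ne3 k), …⟩`, and `S_N16 (RRec₁₁ 𝔯 𝔱)` unfolds (one `rintro ⟨hD, k, rfl⟩`) to `N16At` of that literal at every key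
and run length.

CONTENT.
§1 THE READING AND THE ONE-APPLICATION CLOSER AT THE LITERAL — `n16At_ne3Objects_iff` (`Iff.rfl`: `NE3EnergyRateWCov 4 (sfClass 4 L o.Nper o.ε) L o.Nper o.b o.g o.C
o.Λ₁ o.Λ₂' o.dom`, `L = ne3LOfRecord₁₁ F`); `inEndRegime_ne3Objects_iff` (the PROVISO at the literal: «`1 ≤ o.Nper ∧ 0 < o.g ∧ 0 < o.ε ≤ radiusOfRecord N F.L o.Nper ∧ 0 ≤
o.Λ₁ ≤ radiusOfRecord N F.L o.Nper ∧ 0 ≤ o.b ≤ o.ε∕2 ∧ constOfRecord N F.L o.Nper o.g ≤ o.C`» — `2 ≤ L` is the family's, RR-1's `two_le_ne3LOfRecord₁₁`);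
**`n16At_ne3Objects_of_inEndRegime_printSlot`** — N16 at the literal from the proviso and `PrintSlot` (file 1's closer).
§2 THE K4 STUB AT EVERY HOME OF LAYER B's SHAPE (parameters: the residual assignment `𝔯`, any `RRec`; hypotheses «ADMITS only the literal bundles of `𝔯` at the
key, some run length» ∕ «ATTAINS every such bundle» — both one `rfl`-unpacking for `RRec₁₁ 𝔯 𝔱`): **`s_N16_of_admits_assignment`** (THE KNIT: proviso + slot at every
keyed datum and run length ⇒ `S_N16 RRec`), `s_N16_iff_of_admits_attains_assignment` (what `S_N16 RRec` SAYS there), `s_N16_of_admits_assignment_params` (the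
θ-SUFFICIENT form a prover of the pin discharges: proviso + slot at EVERY admissible `θ : Stage11Params F N` with provisos, transported to the canonical parameter
by RR-2's `IsDatumOfRecord₁₁C.forall_params` pattern).
§3 N21's FACE — `covRoot_ne3Objects_of_s_N16`: under `S_N16 RRec`, at every admitted bundle equal to the literal, the covariant root with `L = ne3LOfRecord₁₁ F`.
§4 THE JUNK TESTS AT THE OBJECT TYPE [decided toys] — `n16At_ne3Objects_of_dom_empty`; `n16At_ne3Objects_flatDom` (objects whose `dom` is the flat stratum of
period `o.Nper ≥ 1` with non-negative `ε, C, Λ₁, Λ₂'` satisfy N16 at every family — n16-a's `n16At_flatStratum`); `not_n16At_ne3Objects_negLip` (objects with `Λ₁ =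
−1`, `g = gradConst 4 c′`, flat data VIOLATE it — file 2's refuting carrier); **`s_N16_of_admits_flatAssignment`** (a home admitting only the bundles of an
assignment whose NE3 objects have flat data and non-negative letters HAS `S_N16` — content-free); **`not_s_N16_of_attains_negLipAssignment`** (a home attaining, at
some datum of record, a bundle of an assignment with a negative-Lipschitz object has NO `S_N16`).  So `S_N16 (RRec₁₁ 𝔯 𝔱)` is DECIDED BY THE PIN of `𝔯 · .ne3`: the
LOCATED OBJECT for that pin is the dictionary «the record's retained unit-lattice configurations (`T4Continuum.GaugeField (F.P K) j (SU N)`, def-R's `regSuppOfRecord`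
∕ the χ-supports) ↔ NE3's `o.Nper`-periodic data `(Fin 4 → ℤ) → Fin 4 → M_N(ℂ)ˣ`» (no such bridge in the tree today — `B11Eq44COperatorTorus.perCfg` is the `TSite`
model's), with `o.Nper` a period FIXED PER FAMILY (file 1: THE END's radius depends on it) and the letters inside `InEndRegime`.

HONEST FRAMING.  Kernel bookkeeping by name (`Iff.rfl`, file 1's closer, file 2's toys, RR-1∕RR-2's faces); no estimate; `S_N16` NOT proved for the home of record
(layer B not landed; its content `PrintSlot` = N05's [Balaban1985RegularSpaces] Thm 4 at the record's pairs + N07's [Balaban1985Variational] Thm 1 (8)+(10),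
unproved in the tree; the residual assignment unpinned); **N16 ∕ NE3 is NOT discharged**; count-neutral; one finite four-torus at fixed ε — NOT ℝ⁴, NOT infinite
volume, NOT OS, NOT a mass gap, NOT Clay.
-/

set_option autoImplicit false

open scoped BigOperators Matrix Matrix.Norms.L2Operator
open NormedSpace

namespace Summit.QuantumFields.YangMills.BalabanUVNodes.N16AtRateRecord11

open Literature.MathematicalPhysics.QuantumFieldTheory.Balaban1983to89
open Literature.MathematicalPhysics.QuantumFieldTheory.Balaban1983to89.T4Continuum (T4Family ULoop FiniteEpsData)
open B7Prop1Explicit B7Prop2Explicit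
open T4AveragingDeficitWallBoundary (IsPeriodicCfg)
open Node00 (IsDatumOfRecord₁₁C Stage11Params NE3Objects₁₁ RateObjects₁₁ RateAssignment₁₁ ne3LOfRecord₁₁ two_le_ne3LOfRecord₁₁ nonempty_rateObjects₁₁
  datumOfRecord₁₁ isDatumOfRecord₁₁C_datumOfRecord₁₁)
open Summit.QuantumFields.BalabanUV.T4Continuum
open MinimalActionRate (sfClass)
open MinimalActionRefine (gradConst)
open MinimalActionWitness (flatCfg)
open NE3EnergyShapes (IsUnitarySite)
open NE3EnergyWeightedCovShape (NE3EnergyRateWCov)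
open YMDAG.UVSplit (Datum NE3Carriers RateCarriers RateRecordPred N16At S_N16)
open Summit.QuantumFields.YangMills.BalabanUVNodes.N16AtRecord (n16At_flatStratum)
open Summit.QuantumFields.YangMills.BalabanUVNodes.N16Regime (PrintSlot InEndRegime radiusOfRecord constOfRecord n16At_of_inEndRegime_printSlot
  inEndRegime_iff_of_familyL)
open Summit.QuantumFields.YangMills.BalabanUVNodes.N16AtRecord11 (n16At_of_dom_empty not_n16At_flatStratum_negLip)

noncomputable section

variable {N : ℕ} [NeZero N]

/-! ## §1 The reading, the proviso and the one-application closer at the home's NE3 literal -/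

omit [NeZero N] in
/-- **WHAT N16 SAYS AT THE HOME's NE3 BUNDLE** (`Iff.rfl`): for one construction's objects `o` at a family `F`, `N16At ⟨ne3LOfRecord₁₁ F, o.Nper, …, o.dom⟩` IS the
covariant root `NE3EnergyRateWCov 4 (sfClass 4 L o.Nper o.ε) L o.Nper o.b o.g o.C o.Λ₁ o.Λ₂' o.dom` with `L = ne3LOfRecord₁₁ F` (`= F.L`). [folklore] -/
theorem n16At_ne3Objects_iff (F : T4Family) (o : NE3Objects₁₁ N) :
    N16At (⟨ne3LOfRecord₁₁ F, o.Nper, o.ε, o.b, o.g, o.C, o.Λ₁, o.Λ₂', o.dom⟩ : NE3Carriers N) ↔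
      NE3EnergyRateWCov 4 (sfClass 4 (ne3LOfRecord₁₁ F) o.Nper o.ε) (ne3LOfRecord₁₁ F) o.Nper o.b o.g o.C o.Λ₁ o.Λ₂' o.dom :=
  Iff.rfl

/-- **THE PROVISO AT THE HOME's NE3 BUNDLE** — `InEndRegime` at the literal, the block-factor clause being the family's (`two_le_ne3LOfRecord₁₁`): period `≥ 1`,
positive coupling letter, class radius and Hölder letter inside `radiusOfRecord N F.L o.Nper`, `0 ≤ b ≤ ε∕2`, constant at least `constOfRecord N F.L o.Nper o.g`.
What the residual assignment's pin must DISPLAY (RR-2 PRE-READ §C item 2: the home exposes, never asserts). [folklore] -/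
theorem inEndRegime_ne3Objects_iff (F : T4Family) (o : NE3Objects₁₁ N) :
    InEndRegime (⟨ne3LOfRecord₁₁ F, o.Nper, o.ε, o.b, o.g, o.C, o.Λ₁, o.Λ₂', o.dom⟩ : NE3Carriers N) ↔
      1 ≤ o.Nper ∧ 0 < o.g ∧ 0 < o.ε ∧ o.ε ≤ radiusOfRecord N F.L o.Nper ∧ 0 ≤ o.Λ₁ ∧ o.Λ₁ ≤ radiusOfRecord N F.L o.Nper ∧
        0 ≤ o.b ∧ o.b ≤ o.ε / 2 ∧ constOfRecord N F.L o.Nper o.g ≤ o.C :=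
  inEndRegime_iff_of_familyL (F := F) rfl

/-- **N16 AT THE HOME's NE3 BUNDLE IN ONE APPLICATION**: the proviso and the print-form slot at the literal give `N16At` (file 1's
`n16At_of_inEndRegime_printSlot`). [folklore] -/
theorem n16At_ne3Objects_of_inEndRegime_printSlot (F : T4Family) (o : NE3Objects₁₁ N)
    (hreg : InEndRegime (⟨ne3LOfRecord₁₁ F, o.Nper, o.ε, o.b, o.g, o.C, o.Λ₁, o.Λ₂', o.dom⟩ : NE3Carriers N))
    (hslot : PrintSlot (⟨ne3LOfRecord₁₁ F, o.Nper, o.ε, o.b, o.g, o.C, o.Λ₁, o.Λ₂', o.dom⟩ : NE3Carriers N)) :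
    N16At (⟨ne3LOfRecord₁₁ F, o.Nper, o.ε, o.b, o.g, o.C, o.Λ₁, o.Λ₂', o.dom⟩ : NE3Carriers N) :=
  n16At_of_inEndRegime_printSlot hreg hslot

/-! ## §2 The K4 stub at every home of layer B's shape (residual assignment `𝔯`; key `IsDatumOfRecord₁₁C`; run length `k`) -/

section Home

variable (𝔯 : RateAssignment₁₁ N) (RRec : RateRecordPred N)

/-- **THE KNIT — `S_N16` AT EVERY HOME ADMITTING ONLY THE NE3 BUNDLES OF THE ASSIGNMENT `𝔯` AT THE DATUM KEY**: if every admitted `R` has `R.ne3` equal to the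
literal of `(𝔯 F hD.params g₀ os).ne3 k` for some key `hD : IsDatumOfRecord₁₁C F N D` and run length `k` (layer B's `RRec₁₁ 𝔯 𝔱`: one `⟨hD, k, rfl⟩`), then the
proviso `InEndRegime` and the slot `PrintSlot` at every such literal give `S_N16 RRec`.  The two hypotheses are the pin's DISPLAY (proviso) and its CONTENT
(N05's Theorem 4 at the bundle's pairs + N07's `LeafH3sup`) — neither is asserted here. [folklore] -/
theorem s_N16_of_admits_assignment
    (hadm : ∀ (F : T4Family) (D : Datum F N) (g₀ : ℕ → ℝ) (os : List (ULoop F)) (R : RateCarriers N), RRec F D g₀ os R →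
      ∃ (hD : IsDatumOfRecord₁₁C F N D) (k : ℕ) (o : NE3Objects₁₁ N), o = (𝔯 F hD.params g₀ os).ne3 k ∧
        R.ne3 = ⟨ne3LOfRecord₁₁ F, o.Nper, o.ε, o.b, o.g, o.C, o.Λ₁, o.Λ₂', o.dom⟩)
    (h : ∀ (F : T4Family) (D : Datum F N) (hD : IsDatumOfRecord₁₁C F N D) (g₀ : ℕ → ℝ) (os : List (ULoop F)) (k : ℕ) (o : NE3Objects₁₁ N),
      o = (𝔯 F hD.params g₀ os).ne3 k →
        InEndRegime (⟨ne3LOfRecord₁₁ F, o.Nper, o.ε, o.b, o.g, o.C, o.Λ₁, o.Λ₂', o.dom⟩ : NE3Carriers N) ∧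
          PrintSlot (⟨ne3LOfRecord₁₁ F, o.Nper, o.ε, o.b, o.g, o.C, o.Λ₁, o.Λ₂', o.dom⟩ : NE3Carriers N)) :
    S_N16 RRec := by
  intro F D g₀ os R hR
  obtain ⟨hD, k, o, ho, hne3⟩ := hadm F D g₀ os R hR
  rw [hne3]
  exact n16At_of_inEndRegime_printSlot (h F D hD g₀ os k o ho).1 (h F D hD g₀ os k o ho).2

/-- **WHAT `S_N16` SAYS AT SUCH A HOME** (`Iff`): admitting only, and ATTAINING, the literal bundles of `𝔯` at the key, `S_N16 RRec` IS «at every datum of record,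
every `(g₀, os)` and every run length `k`, N16 at the literal of `(𝔯 F hD.params g₀ os).ne3 k`». [folklore] -/
theorem s_N16_iff_of_admits_attains_assignment
    (hadm : ∀ (F : T4Family) (D : Datum F N) (g₀ : ℕ → ℝ) (os : List (ULoop F)) (R : RateCarriers N), RRec F D g₀ os R →
      ∃ (hD : IsDatumOfRecord₁₁C F N D) (k : ℕ) (o : NE3Objects₁₁ N), o = (𝔯 F hD.params g₀ os).ne3 k ∧
        R.ne3 = ⟨ne3LOfRecord₁₁ F, o.Nper, o.ε, o.b, o.g, o.C, o.Λ₁, o.Λ₂', o.dom⟩)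
    (hatt : ∀ (F : T4Family) (D : Datum F N) (hD : IsDatumOfRecord₁₁C F N D) (g₀ : ℕ → ℝ) (os : List (ULoop F)) (k : ℕ),
      ∃ R : RateCarriers N, RRec F D g₀ os R ∧ ∀ o : NE3Objects₁₁ N, o = (𝔯 F hD.params g₀ os).ne3 k →
        R.ne3 = ⟨ne3LOfRecord₁₁ F, o.Nper, o.ε, o.b, o.g, o.C, o.Λ₁, o.Λ₂', o.dom⟩) :
    S_N16 RRec ↔ ∀ (F : T4Family) (D : Datum F N) (hD : IsDatumOfRecord₁₁C F N D) (g₀ : ℕ → ℝ) (os : List (ULoop F)) (k : ℕ) (o : NE3Objects₁₁ N),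
      o = (𝔯 F hD.params g₀ os).ne3 k → N16At (⟨ne3LOfRecord₁₁ F, o.Nper, o.ε, o.b, o.g, o.C, o.Λ₁, o.Λ₂', o.dom⟩ : NE3Carriers N) := by
  constructor
  · intro hS F D hD g₀ os k o ho
    obtain ⟨R, hR, hne3⟩ := hatt F D hD g₀ os k
    rw [← hne3 o ho]
    exact hS F D g₀ os R hR
  · intro hS F D g₀ os R hR
    obtain ⟨hD, k, o, ho, hne3⟩ := hadm F D g₀ os R hR
    rw [hne3]
    exact hS F D hD g₀ os k o ho

/-- **THE θ-SUFFICIENT FORM OF THE KNIT** — what a prover of the pin discharges: the proviso and the slot at the literal of `(𝔯 F θ g₀ os).ne3 k` for EVERY admissible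
`θ : Stage11Params F N` with provisos (no canonical parameter in sight); RR-2's `IsDatumOfRecord₁₁C.params` is such a `θ` (`.admissible`, `.provisos`), so the home
form follows. [folklore] -/
theorem s_N16_of_admits_assignment_params
    (hadm : ∀ (F : T4Family) (D : Datum F N) (g₀ : ℕ → ℝ) (os : List (ULoop F)) (R : RateCarriers N), RRec F D g₀ os R →
      ∃ (hD : IsDatumOfRecord₁₁C F N D) (k : ℕ) (o : NE3Objects₁₁ N), o = (𝔯 F hD.params g₀ os).ne3 k ∧
        R.ne3 = ⟨ne3LOfRecord₁₁ F, o.Nper, o.ε, o.b, o.g, o.C, o.Λ₁, o.Λ₂', o.dom⟩)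
    (h : ∀ (F : T4Family) (θ : Stage11Params F N), θ.Provisos₁₁ → θ.Admissible → ∀ (g₀ : ℕ → ℝ) (os : List (ULoop F)) (k : ℕ) (o : NE3Objects₁₁ N),
      o = (𝔯 F θ g₀ os).ne3 k →
        InEndRegime (⟨ne3LOfRecord₁₁ F, o.Nper, o.ε, o.b, o.g, o.C, o.Λ₁, o.Λ₂', o.dom⟩ : NE3Carriers N) ∧
          PrintSlot (⟨ne3LOfRecord₁₁ F, o.Nper, o.ε, o.b, o.g, o.C, o.Λ₁, o.Λ₂', o.dom⟩ : NE3Carriers N)) :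
    S_N16 RRec :=
  s_N16_of_admits_assignment 𝔯 RRec hadm fun F _ hD g₀ os k o ho => h F hD.params hD.provisos hD.admissible g₀ os k o ho

/-! ## §3 N21's face at the home's NE3 bundle -/

/-- **N21's FACE AT THE HOME** — under `S_N16 RRec`, every admitted bundle equal to the literal of objects `o` at family `F` carries the covariant root
`NE3EnergyRateWCov 4 (sfClass 4 L o.Nper o.ε) L o.Nper o.b o.g o.C o.Λ₁ o.Λ₂' o.dom`, `L = ne3LOfRecord₁₁ F` (what `…N21ClosenessAtRecord` reads as `hcov`). [folklore] -/
theorem covRoot_ne3Objects_of_s_N16 (hS : S_N16 RRec) {F : T4Family} {D : Datum F N} {g₀ : ℕ → ℝ} {os : List (ULoop F)} {R : RateCarriers N}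
    (hR : RRec F D g₀ os R) {o : NE3Objects₁₁ N} (hne3 : R.ne3 = ⟨ne3LOfRecord₁₁ F, o.Nper, o.ε, o.b, o.g, o.C, o.Λ₁, o.Λ₂', o.dom⟩) :
    NE3EnergyRateWCov 4 (sfClass 4 (ne3LOfRecord₁₁ F) o.Nper o.ε) (ne3LOfRecord₁₁ F) o.Nper o.b o.g o.C o.Λ₁ o.Λ₂' o.dom := by
  have h16 := hS F D g₀ os R hR
  rw [hne3] at h16
  exact h16

end Home

/-! ## §4 THE JUNK TESTS AT THE OBJECT TYPE: the residual assignment's `ne3` decides -/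

omit [NeZero N] in
/-- **Objects with EMPTY admissible data give N16 for free** at every family [decided toy] (file 2's `n16At_of_dom_empty`). [folklore] -/
theorem n16At_ne3Objects_of_dom_empty (F : T4Family) (o : NE3Objects₁₁ N) (h : o.dom = ∅) :
    N16At (⟨ne3LOfRecord₁₁ F, o.Nper, o.ε, o.b, o.g, o.C, o.Λ₁, o.Λ₂', o.dom⟩ : NE3Carriers N) :=
  n16At_of_dom_empty _ h

/-- **Objects whose data are the FLAT STRATUM of their period give N16 for free** at every family [decided toy] (`o.Nper ≥ 1`, `o.ε, o.C, o.Λ₁, o.Λ₂' ≥ 0`; n16-a's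
`n16At_flatStratum`, witness `Z = 0`; `1 ≤ L` from `two_le_ne3LOfRecord₁₁`). [folklore] -/
theorem n16At_ne3Objects_flatDom (F : T4Family) (o : NE3Objects₁₁ N) (hN : 1 ≤ o.Nper) (hε : 0 ≤ o.ε) (hC : 0 ≤ o.C) (hΛ₁ : 0 ≤ o.Λ₁) (hΛ₂' : 0 ≤ o.Λ₂')
    (hdom : o.dom = {v : Site 4 → Fin 4 → (Matrix (Fin N) (Fin N) ℂ)ˣ | IsPeriodicCfg v (o.Nper : ℤ) ∧ ∃ w : Site 4 → (Matrix (Fin N) (Fin N) ℂ)ˣ,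
      IsUnitarySite w ∧ v = gaugeAct w flatCfg}) :
    N16At (⟨ne3LOfRecord₁₁ F, o.Nper, o.ε, o.b, o.g, o.C, o.Λ₁, o.Λ₂', o.dom⟩ : NE3Carriers N) := by
  rw [hdom]
  exact n16At_flatStratum (le_trans one_le_two (two_le_ne3LOfRecord₁₁ F)) hN hε o.b o.g hC hΛ₁ hΛ₂'

/-- **Objects with a NEGATIVE covariant-Lipschitz letter VIOLATE N16** at every family [decided toy] (`o.Λ₁ = −1`, `o.g = gradConst 4 c′`, flat data of period
`o.Nper`, `o.ε, o.b, c′ ≥ 0`; file 2's refuting carrier `not_n16At_flatStratum_negLip`). [folklore] -/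
theorem not_n16At_ne3Objects_negLip (F : T4Family) (o : NE3Objects₁₁ N) {c' : ℝ} (hε : 0 ≤ o.ε) (hb : 0 ≤ o.b) (hc' : 0 ≤ c') (hg : o.g = gradConst 4 c')
    (hΛ₁ : o.Λ₁ = -1)
    (hdom : o.dom = {v : Site 4 → Fin 4 → (Matrix (Fin N) (Fin N) ℂ)ˣ | IsPeriodicCfg v (o.Nper : ℤ) ∧ ∃ w : Site 4 → (Matrix (Fin N) (Fin N) ℂ)ˣ,
      IsUnitarySite w ∧ v = gaugeAct w flatCfg}) :
    ¬ N16At (⟨ne3LOfRecord₁₁ F, o.Nper, o.ε, o.b, o.g, o.C, o.Λ₁, o.Λ₂', o.dom⟩ : NE3Carriers N) := by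
  rw [hg, hΛ₁, hdom]
  exact not_n16At_flatStratum_negLip (le_trans one_le_two (two_le_ne3LOfRecord₁₁ F)) o.Nper hε hb hc' o.C o.Λ₂'

/-- **JUNK TEST — A HOME ADMITTING ONLY THE BUNDLES OF AN ASSIGNMENT WITH FLAT NE3 DATA HAS `S_N16`, CONTENT-FREE** [decided toy]: if every admitted `R.ne3` is the
literal of some object of `𝔯` (any key, any run length) and every object of `𝔯` has period `≥ 1`, non-negative `ε, C, Λ₁, Λ₂'` and the flat stratum as data, then
`S_N16 RRec` — by `n16At_flatStratum`, with NO slot and NO estimate.  So the PIN of `𝔯 · .ne3 · .dom` to the class of record's ACTUAL data (the configurations the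
two-run consumers N19∕N21 compare) is where N16's content enters the home; R422 at the object type. [folklore] -/
theorem s_N16_of_admits_flatAssignment (𝔯 : RateAssignment₁₁ N) (RRec : RateRecordPred N)
    (hadm : ∀ (F : T4Family) (D : Datum F N) (g₀ : ℕ → ℝ) (os : List (ULoop F)) (R : RateCarriers N), RRec F D g₀ os R →
      ∃ (θ : Stage11Params F N) (k : ℕ) (o : NE3Objects₁₁ N), o = (𝔯 F θ g₀ os).ne3 k ∧
        R.ne3 = ⟨ne3LOfRecord₁₁ F, o.Nper, o.ε, o.b, o.g, o.C, o.Λ₁, o.Λ₂', o.dom⟩)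
    (hflat : ∀ (F : T4Family) (θ : Stage11Params F N) (g₀ : ℕ → ℝ) (os : List (ULoop F)) (k : ℕ),
      1 ≤ ((𝔯 F θ g₀ os).ne3 k).Nper ∧ 0 ≤ ((𝔯 F θ g₀ os).ne3 k).ε ∧ 0 ≤ ((𝔯 F θ g₀ os).ne3 k).C ∧ 0 ≤ ((𝔯 F θ g₀ os).ne3 k).Λ₁ ∧
        0 ≤ ((𝔯 F θ g₀ os).ne3 k).Λ₂' ∧
        ((𝔯 F θ g₀ os).ne3 k).dom = {v : Site 4 → Fin 4 → (Matrix (Fin N) (Fin N) ℂ)ˣ | IsPeriodicCfg v (((𝔯 F θ g₀ os).ne3 k).Nper : ℤ) ∧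
          ∃ w : Site 4 → (Matrix (Fin N) (Fin N) ℂ)ˣ, IsUnitarySite w ∧ v = gaugeAct w flatCfg}) :
    S_N16 RRec := by
  intro F D g₀ os R hR
  obtain ⟨θ, k, o, ho, hne3⟩ := hadm F D g₀ os R hR
  obtain ⟨hN, hε, hC, hΛ₁, hΛ₂', hdom⟩ := hflat F θ g₀ os k
  rw [hne3]
  subst ho
  exact n16At_ne3Objects_flatDom F _ hN hε hC hΛ₁ hΛ₂' hdom

/-- **JUNK TEST — A HOME ATTAINING, AT SOME DATUM OF RECORD, A BUNDLE OF AN ASSIGNMENT WITH A NEGATIVE-LIPSCHITZ OBJECT HAS NO `S_N16`** [decided toy]: letters left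
free in the residual assignment are refuted — the pin owes `InEndRegime`. [folklore] -/
theorem not_s_N16_of_attains_negLipAssignment (𝔯 : RateAssignment₁₁ N) (RRec : RateRecordPred N) {F : T4Family} {D : Datum F N} {θ : Stage11Params F N}
    {g₀ : ℕ → ℝ} {os : List (ULoop F)} {k : ℕ} {c' : ℝ} {R : RateCarriers N} (hR : RRec F D g₀ os R)
    (hne3 : R.ne3 = ⟨ne3LOfRecord₁₁ F, ((𝔯 F θ g₀ os).ne3 k).Nper, ((𝔯 F θ g₀ os).ne3 k).ε, ((𝔯 F θ g₀ os).ne3 k).b, ((𝔯 F θ g₀ os).ne3 k).g,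
      ((𝔯 F θ g₀ os).ne3 k).C, ((𝔯 F θ g₀ os).ne3 k).Λ₁, ((𝔯 F θ g₀ os).ne3 k).Λ₂', ((𝔯 F θ g₀ os).ne3 k).dom⟩)
    (hε : 0 ≤ ((𝔯 F θ g₀ os).ne3 k).ε) (hb : 0 ≤ ((𝔯 F θ g₀ os).ne3 k).b) (hc' : 0 ≤ c') (hg : ((𝔯 F θ g₀ os).ne3 k).g = gradConst 4 c')
    (hΛ₁ : ((𝔯 F θ g₀ os).ne3 k).Λ₁ = -1)
    (hdom : ((𝔯 F θ g₀ os).ne3 k).dom = {v : Site 4 → Fin 4 → (Matrix (Fin N) (Fin N) ℂ)ˣ | IsPeriodicCfg v (((𝔯 F θ g₀ os).ne3 k).Nper : ℤ) ∧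
      ∃ w : Site 4 → (Matrix (Fin N) (Fin N) ℂ)ˣ, IsUnitarySite w ∧ v = gaugeAct w flatCfg}) :
    ¬ S_N16 RRec := by
  intro hS
  have h16 := hS F D g₀ os R hR
  rw [hne3] at h16
  exact not_n16At_ne3Objects_negLip F ((𝔯 F θ g₀ os).ne3 k) hε hb hc' hg hΛ₁ hdom h16

/-- **THE OBJECT TYPE ADMITS BOTH KINDS OF ASSIGNMENT** (so the two junk tests bite): from RR-1's `nonempty_rateObjects₁₁`, for ANY prescribed NE3 objects `o` there is a
residual assignment whose NE3 component is constantly `o` (U3 ∕ NE2 components arbitrary).  Hence a flat assignment EXISTS (`s_N16` junk-closable) and a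
negative-Lipschitz one EXISTS (`S_N16` refutable where attained) — the home's `S_N16` is exactly as good as the pin of `𝔯`. [folklore] -/
theorem exists_assignment_ne3_const (o : NE3Objects₁₁ N) :
    ∃ 𝔯 : RateAssignment₁₁ N, ∀ (F : T4Family) (θ : Stage11Params F N) (g₀ : ℕ → ℝ) (os : List (ULoop F)) (k : ℕ), (𝔯 F θ g₀ os).ne3 k = o := by
  obtain ⟨r₀⟩ := nonempty_rateObjects₁₁ (N := N)
  exact ⟨fun _ _ _ _ => ⟨r₀.u3, fun _ => o, r₀.ne2⟩, fun _ _ _ _ _ => rfl⟩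

end

end Summit.QuantumFields.YangMills.BalabanUVNodes.N16AtRateRecord11
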